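import Summits.BirchSwinnertonDyer.BirchSwinnertonDyer.Theorems.CyclotomicUntwistGNineSpecialFibre
import HarnessLib

/-!
# (G₉) special fibres, invariant form: the residue `b̄` of the leaf models read from `c₄, c₆`
# — kernel half of the closed form (N) of LAW L-a3 (route `CyclotomicUntwist`, crux K1 `PSRankOneLowerHalfAtThree`)

Cell `pub/bsd-wall` (D-0145 line `route-BirchSwinnertonDyer-CyclotomicUntwist`), seat `bsd-line-cycu-p3` (gen 5).
Helper toward K1 (stmt-BirchSwinnertonDyer-21580) / K2 (stmt-21581). THEOREMS ONLY (no definition, no named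
fact, no `sorry`); BSD is not proved by this file and no crux is.

`CyclotomicUntwistGNineSpecialFibre` (p610052) shows that the good model over `ℚ(ζ₉)` of the leaf-II family
`V = ⟨0, 3(3α₁ − g), 0, 9β, 3(3γ₁ + g)⟩` (`g = ±1`, `v₃(Δ) = 4`) reduces mod `w` to `y² = x³ − x + γ̄₁`, and that
of the leaf-IV family `V = ⟨0, 9α, 0, 9(3β₁ − 1), 9(3γ₁ + g)⟩` (`v₃(Δ) = 6`) to `y² = x³ − x − γ̄₁`. This file
expresses the residue `γ₁ mod 3` through the INVARIANTS `c₄(V), c₆(V)` of the integer model, i.e. in the Kraus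
currency of the cell's laws (LAW L-c3 / L-t3 / L-w3): pure integer algebra.

* leaf II (`leafII_c₄`, `leafII_c₆`, `leafII_gamma₁_congr`): `c₄ = 144·((3α₁ − g)² − 3β)`,
  `c₆ = 27·(−64(3α₁ − g)³ + 288(3α₁ − g)β − 96(3γ₁ + g))`; hence `c₆/27 ≡ g (mod 3)`, `9 ∣ c₆/27 + 32g`,
  `3 ∣ c₄/144 − 1`, and **`γ₁ ≡ (c₆/27 + 32g)/9 + g·(c₄/144 − 1)/3 (mod 3)`**;
* leaf IV (`leafIV_c₄`, `leafIV_c₆`, `leafIV_gamma₁_congr`): `c₄ = 432·(3α² − 3β₁ + 1)`,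
  `c₆ = 7776·(−6α³ + 9αβ₁ − 3α − 3γ₁ − g)`; hence `c₆/7776 ≡ −g (mod 3)` and **`γ₁ ≡ −(c₆/7776 + g)/3 (mod 3)`**.

Translation to a curve `W/ℚ` on a PS row (informal, memo `Cruxes/PSRankOneLowerHalfAtThree/LAW-La3-KERNEL-v2.md`
§1 (N)): the leaf model `V` is reached from the integral minimal model by `x ↦ 4x + t` (`c₄(V) = 16·c₄(W)`,
`c₆(V) = 64·c₆(W)`), so with `c₆' := c₆(W)/3^{v₃ c₆(W)}`, `c₄' := c₄(W)/3^{v₃ c₄(W)}` these congruences are the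
closed form (N): `v = 4`: `c₄' ≡ 1 + 3u`, `c₆' ≡ 4σ(1 + 9λ)`, `b̄ = γ̄₁`, `a_w = 3σ⟨1 − λ − u⟩`; `v = 6`:
`c₆' ≡ σ(1 + 3m)`, `b̄ = −γ̄₁`, `a_w = 3σ⟨m − 1⟩` (verified on 3 996 + 416 classes there; the point count and the
identification `a_w = tr a₃(g)` are NOT formalised).

References: J. Tate, *Algorithm for determining the type of a singular fiber in an elliptic pencil* (Antwerp IV,
LNM 476, 1975), §7 [Tate1975]; A. Kraus, Manuscripta Math. 69 (1990) 353–385 [Kraus1990].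
-/

set_option linter.dupNamespace false

namespace Summit.BirchSwinnertonDyer.BirchSwinnertonDyer.Theorems.GNineSpecialFibre

/-! ### `g = ±1` -/

/-- `g² = 1` over `ℤ` means `g = 1 ∨ g = −1`. [folklore] -/
theorem eq_one_or_eq_neg_one_of_sq {g : ℤ} (hg : g ^ 2 = 1) : g = 1 ∨ g = -1 := by
  rcases Int.eq_one_or_neg_one_of_mul_eq_one' (show g * g = 1 by rw [← sq]; exact hg) with ⟨h, -⟩ | ⟨h, -⟩
  · exact Or.inl h
  · exact Or.inr h

/-! ### Leaf II: `V = ⟨0, 3(3α₁ − g), 0, 9β, 3(3γ₁ + g)⟩` -/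

/-- `c₄` of the leaf-II integer model: `c₄ = 144·(9α₁² − 6α₁g + g² − 3β)`. [cite: Tate1975, §7] -/
theorem leafII_c₄ (α₁ β γ₁ g : ℤ) :
    (⟨0, 3 * (3 * α₁ - g), 0, 9 * β, 3 * (3 * γ₁ + g)⟩ : WeierstrassCurve ℤ).c₄ =
      144 * (9 * α₁ ^ 2 - 6 * α₁ * g + g ^ 2 - 3 * β) := by
  simp only [WeierstrassCurve.c₄, WeierstrassCurve.b₂, WeierstrassCurve.b₄]
  ring

/-- `c₆` of the leaf-II integer model:
`c₆ = 27·(−1728α₁³ + 1728α₁²g − 576α₁g² + 64g³ + 864α₁β − 288gβ − 288γ₁ − 96g)`. [cite: Tate1975, §7] -/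
theorem leafII_c₆ (α₁ β γ₁ g : ℤ) :
    (⟨0, 3 * (3 * α₁ - g), 0, 9 * β, 3 * (3 * γ₁ + g)⟩ : WeierstrassCurve ℤ).c₆ =
      27 * (-1728 * α₁ ^ 3 + 1728 * α₁ ^ 2 * g - 576 * α₁ * g ^ 2 + 64 * g ^ 3 + 864 * α₁ * β
        - 288 * g * β - 288 * γ₁ - 96 * g) := by
  simp only [WeierstrassCurve.c₆, WeierstrassCurve.b₂, WeierstrassCurve.b₄, WeierstrassCurve.b₆]
  ring

/-- **Leaf II: the special-fibre residue `γ̄₁` from `c₄, c₆`.** For `g = ±1`: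
`144 ∣ c₄`, `27 ∣ c₆`, `c₆/27 ≡ g (mod 3)`, `9 ∣ c₆/27 + 32g`, `3 ∣ c₄/144 − 1`, and
`γ₁ ≡ (c₆/27 + 32g)/9 + g·(c₄/144 − 1)/3 (mod 3)`. With `leafII_special_fibre` (`a₆' ≡ γ₁ mod w`) this reads
the special fibre `y² = x³ − x + γ̄₁` of the good model over `ℚ(ζ₉)` off the invariants of `V`.
[cite: Tate1975, §7] [cite: Kraus1990, Théorème 1 (p = 3)] -/
theorem leafII_gamma₁_congr (α₁ β γ₁ g : ℤ) (hg : g ^ 2 = 1) :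
    let V : WeierstrassCurve ℤ := ⟨0, 3 * (3 * α₁ - g), 0, 9 * β, 3 * (3 * γ₁ + g)⟩
    (144 : ℤ) ∣ V.c₄ ∧ (27 : ℤ) ∣ V.c₆ ∧ (3 : ℤ) ∣ V.c₆ / 27 - g ∧ (9 : ℤ) ∣ V.c₆ / 27 + 32 * g ∧
      (3 : ℤ) ∣ V.c₄ / 144 - 1 ∧
      (3 : ℤ) ∣ γ₁ - ((V.c₆ / 27 + 32 * g) / 9 + g * ((V.c₄ / 144 - 1) / 3)) := by
  intro V
  have h4 : V.c₄ = 144 * (9 * α₁ ^ 2 - 6 * α₁ * g + g ^ 2 - 3 * β) := leafII_c₄ α₁ β γ₁ g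
  have h6 : V.c₆ = 27 * (-1728 * α₁ ^ 3 + 1728 * α₁ ^ 2 * g - 576 * α₁ * g ^ 2 + 64 * g ^ 3
      + 864 * α₁ * β - 288 * g * β - 288 * γ₁ - 96 * g) := leafII_c₆ α₁ β γ₁ g
  have hq4 : V.c₄ / 144 = 9 * α₁ ^ 2 - 6 * α₁ * g + g ^ 2 - 3 * β := by
    rw [h4, Int.mul_ediv_cancel_left _ (by norm_num)]
  have hq6 : V.c₆ / 27 = -1728 * α₁ ^ 3 + 1728 * α₁ ^ 2 * g - 576 * α₁ * g ^ 2 + 64 * g ^ 3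
      + 864 * α₁ * β - 288 * g * β - 288 * γ₁ - 96 * g := by
    rw [h6, Int.mul_ediv_cancel_left _ (by norm_num)]
  refine ⟨⟨_, h4⟩, ⟨_, h6⟩, ?_, ?_, ?_, ?_⟩
  · rw [hq6]
    rcases eq_one_or_eq_neg_one_of_sq hg with rfl | rfl
    · exact ⟨-576 * α₁ ^ 3 + 576 * α₁ ^ 2 - 192 * α₁ + 288 * α₁ * β - 96 * β - 96 * γ₁ - 11, by ring⟩
    · exact ⟨-576 * α₁ ^ 3 - 576 * α₁ ^ 2 - 192 * α₁ + 288 * α₁ * β + 96 * β - 96 * γ₁ + 11, by ring⟩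
  · rw [hq6]
    rcases eq_one_or_eq_neg_one_of_sq hg with rfl | rfl
    · exact ⟨-192 * α₁ ^ 3 + 192 * α₁ ^ 2 - 64 * α₁ + 96 * α₁ * β - 32 * β - 32 * γ₁, by ring⟩
    · exact ⟨-192 * α₁ ^ 3 - 192 * α₁ ^ 2 - 64 * α₁ + 96 * α₁ * β + 32 * β - 32 * γ₁, by ring⟩
  · rw [hq4]
    rcases eq_one_or_eq_neg_one_of_sq hg with rfl | rfl
    · exact ⟨3 * α₁ ^ 2 - 2 * α₁ - β, by ring⟩
    · exact ⟨3 * α₁ ^ 2 + 2 * α₁ - β, by ring⟩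
  · rw [hq4, hq6]
    rcases eq_one_or_eq_neg_one_of_sq hg with rfl | rfl
    · have e9 : (-1728 * α₁ ^ 3 + 1728 * α₁ ^ 2 * 1 - 576 * α₁ * 1 ^ 2 + 64 * 1 ^ 3 + 864 * α₁ * β
          - 288 * 1 * β - 288 * γ₁ - 96 * 1 + 32 * 1 : ℤ) =
          9 * (-192 * α₁ ^ 3 + 192 * α₁ ^ 2 - 64 * α₁ + 96 * α₁ * β - 32 * β - 32 * γ₁) := by ring
      have e3 : (9 * α₁ ^ 2 - 6 * α₁ * 1 + 1 ^ 2 - 3 * β - 1 : ℤ) = 3 * (3 * α₁ ^ 2 - 2 * α₁ - β) := by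
        ring
      rw [e9, e3, Int.mul_ediv_cancel_left _ (by norm_num), Int.mul_ediv_cancel_left _ (by norm_num)]
      exact ⟨64 * α₁ ^ 3 - 65 * α₁ ^ 2 + 22 * α₁ - 32 * α₁ * β + 11 * β + 11 * γ₁, by ring⟩
    · have e9 : (-1728 * α₁ ^ 3 + 1728 * α₁ ^ 2 * (-1) - 576 * α₁ * (-1) ^ 2 + 64 * (-1) ^ 3
          + 864 * α₁ * β - 288 * (-1) * β - 288 * γ₁ - 96 * (-1) + 32 * (-1) : ℤ) =
          9 * (-192 * α₁ ^ 3 - 192 * α₁ ^ 2 - 64 * α₁ + 96 * α₁ * β + 32 * β - 32 * γ₁) := by ring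
      have e3 : (9 * α₁ ^ 2 - 6 * α₁ * (-1) + (-1) ^ 2 - 3 * β - 1 : ℤ) = 3 * (3 * α₁ ^ 2 + 2 * α₁ - β) := by
        ring
      rw [e9, e3, Int.mul_ediv_cancel_left _ (by norm_num), Int.mul_ediv_cancel_left _ (by norm_num)]
      exact ⟨64 * α₁ ^ 3 + 65 * α₁ ^ 2 + 22 * α₁ - 32 * α₁ * β - 11 * β + 11 * γ₁, by ring⟩

/-! ### Leaf IV: `V = ⟨0, 9α, 0, 9(3β₁ − 1), 9(3γ₁ + g)⟩` -/

/-- `c₄` of the leaf-IV integer model: `c₄ = 432·(3α² − 3β₁ + 1)`. [cite: Tate1975, §7] -/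
theorem leafIV_c₄ (α β₁ γ₁ g : ℤ) :
    (⟨0, 9 * α, 0, 9 * (3 * β₁ - 1), 9 * (3 * γ₁ + g)⟩ : WeierstrassCurve ℤ).c₄ =
      432 * (3 * α ^ 2 - 3 * β₁ + 1) := by
  simp only [WeierstrassCurve.c₄, WeierstrassCurve.b₂, WeierstrassCurve.b₄]
  ring

/-- `c₆` of the leaf-IV integer model: `c₆ = 7776·(−6α³ + 9αβ₁ − 3α − 3γ₁ − g)`. [cite: Tate1975, §7] -/
theorem leafIV_c₆ (α β₁ γ₁ g : ℤ) :
    (⟨0, 9 * α, 0, 9 * (3 * β₁ - 1), 9 * (3 * γ₁ + g)⟩ : WeierstrassCurve ℤ).c₆ =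
      7776 * (-6 * α ^ 3 + 9 * α * β₁ - 3 * α - 3 * γ₁ - g) := by
  simp only [WeierstrassCurve.c₆, WeierstrassCurve.b₂, WeierstrassCurve.b₄, WeierstrassCurve.b₆]
  ring

/-- **Leaf IV: the special-fibre residue `−γ̄₁` from `c₆`.** `7776 ∣ c₆` (`7776 = 2⁵·3⁵`),
`c₆/7776 ≡ −g (mod 3)` and `γ₁ ≡ −(c₆/7776 + g)/3 (mod 3)` (using `α³ ≡ α`). With `leafIV_special_fibre`
(`a₆' ≡ −γ₁ mod w`) this reads the special fibre `y² = x³ − x − γ̄₁` off `c₆(V)`.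
[cite: Tate1975, §7] [cite: Kraus1990, Théorème 1 (p = 3)] -/
theorem leafIV_gamma₁_congr (α β₁ γ₁ g : ℤ) :
    let V : WeierstrassCurve ℤ := ⟨0, 9 * α, 0, 9 * (3 * β₁ - 1), 9 * (3 * γ₁ + g)⟩
    (7776 : ℤ) ∣ V.c₆ ∧ (3 : ℤ) ∣ V.c₆ / 7776 + g ∧ (3 : ℤ) ∣ γ₁ + (V.c₆ / 7776 + g) / 3 := by
  intro V
  have h6 : V.c₆ = 7776 * (-6 * α ^ 3 + 9 * α * β₁ - 3 * α - 3 * γ₁ - g) := leafIV_c₆ α β₁ γ₁ g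
  have hq6 : V.c₆ / 7776 = -6 * α ^ 3 + 9 * α * β₁ - 3 * α - 3 * γ₁ - g := by
    rw [h6, Int.mul_ediv_cancel_left _ (by norm_num)]
  refine ⟨⟨_, h6⟩, ?_, ?_⟩
  · rw [hq6]
    exact ⟨-2 * α ^ 3 + 3 * α * β₁ - α - γ₁, by ring⟩
  · rw [hq6]
    have e3 : (-6 * α ^ 3 + 9 * α * β₁ - 3 * α - 3 * γ₁ - g + g : ℤ) =
        3 * (-2 * α ^ 3 + 3 * α * β₁ - α - γ₁) := by ring
    rw [e3, Int.mul_ediv_cancel_left _ (by norm_num)]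
    -- `γ₁ + (−2α³ + 3αβ₁ − α − γ₁) = −2α³ − α + 3αβ₁ = −2(α³ − α) − 3α + 3αβ₁`, and `3 ∣ α³ − α`
    have hf : (3 : ℤ) ∣ α ^ 3 - α := by
      have h : ((α ^ 3 - α : ℤ) : ZMod 3) = 0 := by
        have key : ∀ x : ZMod 3, x ^ 3 - x = 0 := by decide
        push_cast
        exact key _
      exact (ZMod.intCast_zmod_eq_zero_iff_dvd _ 3).mp h
    obtain ⟨k, hk⟩ := hf
    exact ⟨-2 * k - α + α * β₁, by linear_combination -2 * hk⟩

end Summit.BirchSwinnertonDyer.BirchSwinnertonDyer.Theorems.GNineSpecialFibre
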